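import Mathlib.Analysis.Calculus.Deriv.MeanValue
import Literature.Geometry.Lorentzian.TeukolskyWronskianBound
import Literature.Geometry.Lorentzian.KerrSurfaceGravity
import Literature.Geometry.Lorentzian.KerrSeparatedPotential

/-!
# No well in the threshold cone: the classically forbidden set of the radial principal symbol
# is an interval (stub `stub_coneCensus`, S3 of the line `olver-dunster-uniform-reduction`)

Crux `PhaseMixingCapture.KappaExplicitWaveDecay` (stmt-FinalStateConjecture-10654), line
`olver-dunster-uniform-reduction`, stub S3. With `K(r) = ω(r² + a²) − am` (`Kerr.radialK`),
`Δ(r) = r² − 2Mr + a²` (`Kerr.delta`) and `L = Λ − 2amω`, the principal symbol of the radial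
ODE is the quartic `P(r) = K(r)² − Δ(r)·L`; the statement is that `{r > r₊ | P(r) ≤ 0}` is
order-connected (ONE barrier, no well).

This holds for ALL real `ω`, `m`, `L` and all `0 < M`, `|a| ≤ M` (so we may take `a₁ := 0`,
`ε₀ := 1` and ignore the cone/admissibility hypotheses), by an elementary argument:

* writing `c = ωa² − am` (so `K = ωr² + c`), `P(r) = ω²r⁴ + (2ωc − L)r² + 2MLr + (c² − La²)`
  has NO cubic term, hence `P′(r) = 4ω²r³ + (4ωc − 2L)r + 2ML` is a depressed cubic with
  nonnegative leading coefficient: it is convex on `[0, ∞)`, so on `0 ≤ q < s < t` the values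
  `P′(q) ≤ 0`, `P′(t) < 0` force `P′(s) ≤ 0` (`depressedCubic_le_of_le_of_lt`);
* `P(r₊) = K(r₊)² ≥ 0` since `Δ(r₊) = 0` (`Kerr.delta_rPlus`), and `r₊ > 0` (`Kerr.rPlus_pos`);
* if `r₊ < x ≤ y ≤ z` with `P(x) ≤ 0`, `P(z) ≤ 0` but `P(y) > 0`, three applications of the
  mean value theorem (`exists_hasDerivAt_eq_slope`) on `[r₊, x]`, `[x, y]`, `[y, z]` give
  `q < s < t` in `(r₊, ∞)` with `P′(q) ≤ 0 < P′(s)` and `P′(t) < 0` — contradicting the previous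
  point.

Pure calculus; no named fact is used.
-/

-- the doubled `FinalStateConjecture.FinalStateConjecture` path component trips dupNamespace
set_option linter.dupNamespace false

noncomputable section

namespace Summit.FinalStateConjecture.FinalStateConjecture.Theorems.KappaExplicitWaveDecay.OlverDunsterUniformReduction

open Literature.Geometry.Lorentzian
open MeasureTheory Filter Set Complex
open scoped Topology Manifold ENNReal

/-- A depressed cubic `f(r) = αr³ + βr + γ` with `α ≥ 0` has no interior bump on `[0, ∞)`:
if `0 ≤ q < s < t`, `f(q) ≤ 0` and `f(t) < 0` then `f(s) ≤ 0` (its secant slopes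
`α(u² + uv + v²) + β` are nondecreasing along `0 ≤ q ≤ s ≤ t`). -/
private theorem depressedCubic_le_of_le_of_lt {α β γ q s t : ℝ} (hα : 0 ≤ α) (hq : 0 ≤ q)
    (hqs : q < s) (hst : s < t) (hfq : α * q ^ 3 + β * q + γ ≤ 0)
    (hft : α * t ^ 3 + β * t + γ < 0) : α * s ^ 3 + β * s + γ ≤ 0 := by
  by_contra h
  push Not at h
  -- the two secant slopes
  have h1 : 0 < α * (s ^ 2 + s * q + q ^ 2) + β := by
    have h1' : 0 < (s - q) * (α * (s ^ 2 + s * q + q ^ 2) + β) := by nlinarith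
    exact pos_of_mul_pos_right h1' (sub_pos.2 hqs).le
  have h2 : α * (t ^ 2 + t * s + s ^ 2) + β < 0 := by
    have h2' : (t - s) * (α * (t ^ 2 + t * s + s ^ 2) + β) < 0 := by nlinarith
    exact neg_of_mul_neg_right h2' (sub_pos.2 hst).le
  -- but the second slope dominates the first
  have h3 : s ^ 2 + s * q + q ^ 2 ≤ t ^ 2 + t * s + s ^ 2 := by nlinarith
  have h4 : α * (s ^ 2 + s * q + q ^ 2) ≤ α * (t ^ 2 + t * s + s ^ 2) :=
    mul_le_mul_of_nonneg_left h3 hα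
  linarith

/-- `dK/dr = 2ωr` for `K(r) = ω(r² + a²) − am`. -/
private theorem hasDerivAt_radialK (a ω m r : ℝ) :
    HasDerivAt (Kerr.radialK a ω m) (2 * ω * r) r := by
  have h := ((((hasDerivAt_id r).pow 2).add_const (a ^ 2)).const_mul ω).sub_const (a * m)
  have h' : HasDerivAt (fun x : ℝ ↦ ω * (x ^ 2 + a ^ 2) - a * m) (2 * ω * r) r :=
    h.congr_deriv (by simp; ring)
  exact h'

/-- **The forbidden set is an interval** (general form: all real `ω`, `m`, `L`, `0 < M`,
`|a| ≤ M`). -/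
private theorem ordConnected_forbidden {M a : ℝ} (hM : 0 < M) (ha : |a| ≤ M) (ω m L : ℝ) :
    (Ioi (Kerr.rPlus M a) ∩
      {r : ℝ | Kerr.radialK a ω m r ^ 2 - Kerr.delta M a r * L ≤ 0}).OrdConnected := by
  -- the symbol `P` and its derivative `P'` (a depressed cubic)
  set P : ℝ → ℝ := fun r ↦ Kerr.radialK a ω m r ^ 2 - Kerr.delta M a r * L with hP
  set P' : ℝ → ℝ := fun r ↦
    4 * ω ^ 2 * r ^ 3 + (4 * ω * (ω * a ^ 2 - a * m) - 2 * L) * r + 2 * M * L with hP'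
  have hder : ∀ r, HasDerivAt P (P' r) r := by
    intro r
    have h :=
      ((hasDerivAt_radialK a ω m r).pow 2).sub ((Kerr.hasDerivAt_delta M a r).mul_const L)
    refine h.congr_deriv ?_
    simp only [hP', Kerr.radialK]
    push_cast
    ring
  have hcont : Continuous P := continuous_iff_continuousAt.2 fun r ↦ (hder r).continuousAt
  -- mean value theorem on `[u, v]`
  have hmvt : ∀ u v : ℝ, u < v → ∃ c ∈ Ioo u v, P' c = (P v - P u) / (v - u) := fun u v huv ↦
    exists_hasDerivAt_eq_slope P P' huv hcont.continuousOn fun x _ ↦ hder x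
  -- endpoint data
  have hrp : 0 < Kerr.rPlus M a := Kerr.rPlus_pos hM a
  have hPp : 0 ≤ P (Kerr.rPlus M a) := by
    simp only [hP, Kerr.delta_rPlus ha, zero_mul, sub_zero]
    positivity
  -- order-connectedness
  rw [ordConnected_iff]
  rintro x ⟨hx, hPx⟩ z ⟨_, hPz⟩ _ y ⟨hxy, hyz⟩
  simp only [mem_inter_iff, mem_Ioi, mem_setOf_eq] at hx hPx hPz ⊢
  change P x ≤ 0 at hPx
  change P z ≤ 0 at hPz
  refine ⟨hx.trans_le hxy, ?_⟩
  change P y ≤ 0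
  by_contra hPy
  push Not at hPy
  have hxy' : x < y := lt_of_le_of_ne hxy (by rintro rfl; exact absurd hPx (not_le.2 hPy))
  have hyz' : y < z := lt_of_le_of_ne hyz (by rintro rfl; exact absurd hPz (not_le.2 hPy))
  obtain ⟨q, ⟨hq₁, hq₂⟩, hq⟩ := hmvt _ _ hx
  obtain ⟨s, ⟨hs₁, hs₂⟩, hs⟩ := hmvt _ _ hxy'
  obtain ⟨t, ⟨ht₁, ht₂⟩, ht⟩ := hmvt _ _ hyz'
  have hPq : P' q ≤ 0 := by
    rw [hq]
    exact div_nonpos_of_nonpos_of_nonneg (by linarith) (by linarith)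
  have hPs : 0 < P' s := by
    rw [hs]
    exact div_pos (by linarith) (by linarith)
  have hPt : P' t < 0 := by
    rw [ht]
    exact div_neg_of_neg_of_pos (by linarith) (by linarith)
  have key := depressedCubic_le_of_le_of_lt (α := 4 * ω ^ 2)
    (β := 4 * ω * (ω * a ^ 2 - a * m) - 2 * L) (γ := 2 * M * L) (by positivity)
    (by linarith : (0 : ℝ) ≤ q) (by linarith : q < s) (by linarith : s < t) hPq hPt
  exact absurd key (not_le.2 hPs)

/-- **S3 · `stub_coneCensus`.** For every `M > 0` there are `a₁ < M` and `ε₀ > 0` (here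
`a₁ = 0`, `ε₀ = 1`) such that for all `a₁ ≤ |a| < M`, all admissible `(ω, m, Λ)` with `m ≠ 0`
in the cone `|ω − mω₊| ≤ ε₀|m|`, the forbidden set `{r > r₊ | K(r)² − Δ(r)(Λ − 2amω) ≤ 0}` is
order-connected. (In fact it is order-connected for all real parameters:
`ordConnected_forbidden`.) -/
theorem stub_coneCensus :
    (∀ M : ℝ, 0 < M → ∃ a₁ ε₀ : ℝ, a₁ < M ∧ 0 < ε₀ ∧
      ∀ a : ℝ, a₁ ≤ |a| → Kerr.IsSubextremal M a →
        ∀ (ω : ℝ) (m : ℤ) (Λ : ℝ), Kerr.IsAdmissibleTriple a ω m Λ → m ≠ 0 →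
          |ω - m * Kerr.horizonAngularVelocity M a| ≤ ε₀ * |(m : ℝ)| →
            (Ioi (Kerr.rPlus M a) ∩
              {r : ℝ | Kerr.radialK a ω m r ^ 2 - Kerr.delta M a r * (Λ - 2 * a * m * ω) ≤ 0}).OrdConnected) := by
  intro M hM
  refine ⟨0, 1, hM, one_pos, fun a _ ha ω m Λ _ _ _ ↦ ?_⟩
  exact ordConnected_forbidden hM (le_of_lt ha) ω m (Λ - 2 * a * m * ω)

end Summit.FinalStateConjecture.FinalStateConjecture.Theorems.KappaExplicitWaveDecay.OlverDunsterUniformReduction
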